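import Literature.Computability.FineGrained.PrattSetCoverReduction
import Literature.Computability.FineGrained.PrattSetCoverReductionInstances
import HarnessLib

/-!
# Pratt's reduction from `s`-Set Cover to Balanced Tripartitioning: assembly over instances

Topic `Computability/FineGrained`. The main equivalence of `PrattSetCoverReduction.lean`
(K. Pratt, STOC 2024, arXiv:2311.02774, proof of Cor. 1.10: cover of `[n]` by `≤ t` sets of `𝓕`
↔ balanced tripartition of some `[n] ∖ S` from the boundary families `𝓕''_{t_i,S}`) stated for
the instances of the tree's word-RAM problem `FineGrained.SetCover s`
(`Literature.Computability.Complexity.SetCoverInstance` with `IsSetFamily s`; acceptance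
predicate `HasCoverWithin`) through the glue of `PrattSetCoverReductionInstances.lean`
(`SetCoverInstance.family`, `hasCoverWithin_iff_family`), together with the a-priori size bound
on Pratt's families `𝓕'_m` that the running-time analysis of the dynamic programme uses
("This can be done with dynamic programming in time `binom(n, n/3) · poly(n)`": every `𝓕'_m` is a
family of subsets of `[n]` of size `≤ n/3 + s`).

* `SetCoverInstance.hasCoverWithin_iff_boundary` — for a well-formed
  `s`-instance on `[3q]` with `s ≤ q`: `HasCoverWithin` iff for some `t₀ + t₁ + t₂ ≤ K`, some
  `3s`-set `S = S₀ ⊔ S₁ ⊔ S₂ ⊆ [3q]`, the families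
  `boundaryFamily (prattLayer family q s tᵢ) S Sᵢ (q − s)` contain pairwise disjoint members with
  union `[3q] ∖ S` (which, relabelled to `Fin (3(q − s))`, is `HasTripartition` of the
  corresponding `TripartitioningInstance`, `TripartitioningInstance.hasTripartition_iff_of_map`).
* `card_prattLayer_le` — `|𝓕'_m| ≤ ∑_{i ≤ q+s} binom(|U|, i)`; `card_boundaryFamily_le`.

Not here: machines and running times (see `PrattSetCoverReduction.lean`, "What is NOT here").

## References

* [Pratt2024SCC] K. Pratt, *A stronger connection between the asymptotic rank conjecture and the
  set cover conjecture*, Proc. 56th STOC (2024), doi:10.1145/3618260.3649620, arXiv:2311.02774 —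
  Problem 1.1, Problem 1.3, proof of Cor. 1.10 (pp. 6–7).
-/

namespace Literature.Computability.FineGrained

open Complexity

/-! ## Size of Pratt's families -/

section Card

variable {α : Type*} [DecidableEq α]

/-- `|𝓕'_m| ≤ ∑_{i ≤ q+s} binom(|U|, i)`: Pratt's family `𝓕'_m` consists of subsets of `U` of size
at most `q + s` ("having size at most `n/3 + s` … in time `binom(n, n/3) · poly(n)`").
[cite: Pratt2024SCC, Cor. 1.10 (proof)] -/
theorem card_prattLayer_le {F : Finset (Finset α)} {U : Finset α} (hF : F ⊆ U.powerset)
    (q s m : ℕ) :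
    (prattLayer F q s m).card ≤ ∑ i ∈ Finset.range (q + s + 1), U.card.choose i := by
  calc (prattLayer F q s m).card
      ≤ (disjointUnions (downwardClosure F) (q + s) m).card := Finset.card_filter_le _ _
    _ ≤ ((Finset.range (q + s + 1)).biUnion fun i => U.powersetCard i).card := by
        refine Finset.card_le_card fun A hA => ?_
        have hA' := disjointUnions_subset_filter_powerset (downwardClosure_subset_powerset hF)
          (q + s) m hA
        rw [Finset.mem_filter, Finset.mem_powerset] at hA'
        exact Finset.mem_biUnion.2 ⟨A.card, Finset.mem_range.2 (by omega),
          Finset.mem_powersetCard.2 ⟨hA'.1, rfl⟩⟩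
    _ ≤ ∑ i ∈ Finset.range (q + s + 1), (U.powersetCard i).card := Finset.card_biUnion_le
    _ = ∑ i ∈ Finset.range (q + s + 1), U.card.choose i := by
        simp only [Finset.card_powersetCard]

/-- `|𝓕''_{m,S}| ≤ |𝓕'_m|` (an image of a subfamily). [cite: Pratt2024SCC, Cor. 1.10 (proof)] -/
theorem card_boundaryFamily_le (L : Finset (Finset α)) (S B : Finset α) (c : ℕ) :
    (boundaryFamily L S B c).card ≤ L.card :=
  Finset.card_image_le.trans (Finset.card_filter_le _ _)

end Card

/-! ## The main equivalence over `SetCover s` instances -/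

/-- **Pratt's reduction, instance form.** For a well-formed `s`-set-cover instance `I` on the
ground set `[3q]` (`IsSetFamily s`, `univSize = 3q`, `s ≤ q`) with budget `K`: at most `K` listed
sets cover `[3q]` (`HasCoverWithin`, the acceptance predicate of `FineGrained.SetCover s`) iff for
some `t₀ + t₁ + t₂ ≤ K` and some `3s`-element `S = S₀ ⊔ S₁ ⊔ S₂ ⊆ [3q]` the three boundary
families `𝓕''_{tᵢ,S}` of `I.family` contain pairwise disjoint members with union `[3q] ∖ S`
(a balanced tripartition of `[3q] ∖ S` into `(q − s)`-sets). (Dot-notation extension of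
`Literature.Computability.Complexity.SetCoverInstance`.) [cite: Pratt2024SCC, Cor. 1.10 (proof)] -/
theorem _root_.Literature.Computability.Complexity.SetCoverInstance.hasCoverWithin_iff_boundary
    (I : SetCoverInstance) {s q : ℕ} (hI : I.IsSetFamily s) (hn : I.univSize = 3 * q)
    (hsq : s ≤ q) :
    I.HasCoverWithin ↔
      ∃ m : Fin 3 → ℕ, m 0 + m 1 + m 2 ≤ I.K ∧
      ∃ S ⊆ Finset.range I.univSize, S.card = 3 * s ∧
      ∃ B : Fin 3 → Finset ℕ, (∀ i j, i ≠ j → Disjoint (B i) (B j)) ∧ Finset.univ.biUnion B = S ∧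
      ∃ Y : Fin 3 → Finset ℕ,
        (∀ i, Y i ∈ boundaryFamily (prattLayer I.family q s (m i)) S (B i) (q - s)) ∧
        (∀ i j, i ≠ j → Disjoint (Y i) (Y j)) ∧
        Finset.univ.biUnion Y = Finset.range I.univSize \ S := by
  rw [I.hasCoverWithin_iff_family]
  exact exists_cover_iff_exists_boundary_tripartition (I.family_subset_powerset_range hI)
    (fun X hX => SetCoverInstance.card_le_of_mem_family hI hX) (by rw [Finset.card_range, hn])
    hsq I.K

/-- In that situation every member of a boundary family is a `(q − s)`-subset of
`[3q] ∖ S`, a set of size `3(q − s)` — so the three families form a Balanced Tripartitioning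
instance with block size `q − s` after relabelling. [cite: Pratt2024SCC, Cor. 1.10 (proof)] -/
theorem _root_.Literature.Computability.Complexity.SetCoverInstance.boundaryFamily_wellFormed
    (I : SetCoverInstance) {s q : ℕ} (hI : I.IsSetFamily s) (hn : I.univSize = 3 * q)
    {S : Finset ℕ} (hS : S ⊆ Finset.range I.univSize) (hScard : S.card = 3 * s) (m : ℕ)
    (B : Finset ℕ) {Y : Finset ℕ}
    (hY : Y ∈ boundaryFamily (prattLayer I.family q s m) S B (q - s)) :
    Y.card = q - s ∧ Y ⊆ Finset.range I.univSize \ S ∧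
      (Finset.range I.univSize \ S).card = 3 * (q - s) := by
  refine ⟨card_of_mem_boundaryFamily hY, subset_sdiff_of_mem_boundaryFamily
    (fun X hX => subset_of_mem_prattLayer (I.family_subset_powerset_range hI) hX) hY, ?_⟩
  rw [Finset.card_sdiff_of_subset hS, Finset.card_range, hn, hScard]
  omega

end Literature.Computability.FineGrained
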